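import Summits.ResolutionOfSingularities.ResolutionOfSingularities.Theorems.MarkedTransferCampaignW46MohWindowShadeTerminatesFin
import Summits.ResolutionOfSingularities.ResolutionOfSingularities.Theorems.MarkedTransferCampaignW46MohWindowShadeTerminalCentres
import Literature.AlgebraicGeometry.Resolution.PointBlowupMohBoundAttained
import HarnessLib

/-!
# [OURS · L1 W4.6] Rung (iii) "Moh window" — KERNEL NON-VACUITY WITNESS for the #73-repair statement
  `CampaignW46MohWindowShadeTerminalCentreTerminatesFin` (proofs only; no definitions)

Cell `res-hironaka`, LADDER-RESOLUTION rung L (D-0089), slot W4.6, rung (iii); typer res-L1-type-o1 (OURS typer o1 —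
the typer's VACUITY SELF-CHECK of its own repaired statement p494189, done in the kernel because the decl it replaces was
RULED VACUOUS AS TYPED, OURS-desk #73). `--kind proof --supports stmt-ResolutionOfSingularities-16155 --as helper`.

CONTENT. `antecedent_witness`: over ANY field `K` (with decidable equality), for `p = 3`, `σ = Fin 3`, the walk that starts
at the cleaned terminal state `(F₀, r₀) = (y^{(2,2,1)}, (2,2,1))` — `|r₀| = 5` strictly inside the window `(3, 6)` — and
blows up the coordinate centre `C_{{0,1}}` (`degIn = r₀ 0 + r₀ 1 = 4 ≥ 3`, MINIMAL: dropping either index leaves `2 < 3`)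
in the chart `y_0` at the origin satisfies EVERY hypothesis of `CampaignW46MohWindowShadeTerminalCentreTerminatesFin 3 K
(Fin 3)` with `N = 1`: the first point is equimultiple because the new multiplicities are `(4 − 3, 2, 1) = (1, 2, 1)` of
total `4 ≥ 3` (res-L1-s46-pv-6's `MohWindowShadeTerminalCentres.isEquimultiplePoint_iff` / `step_r_apply`). So the
repaired statement is NOT vacuous beyond its disclosed degenerate slice `N = 0`; `instance_of_terminatesFin` records the
non-trivial instance it yields (`1 + 3 ≤ 5`; the general content is `N ≤ |r₀| − p`). Hand remark (not kernel-checked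
here): continuing with `S 1 = {0,1}`, `j 1 = 0` gives multiplicities `(0, 2, 1)` of total `3`, again equimultiple, so
`N = 2 = |r₀| − p` is attained — the bound is sharp on this walk. Tree tools: `PointBlowup.ordZero_monomial_one`,
`Hauser2010.deletePthPowers_monomial`, `isPthPowerExponent_iff`. Nothing of H. Hironaka's manuscript
[claim: Hironaka2017, status: under-review] is used or asserted. AI-written; AI review is weaker than expert review.
-/

noncomputable section

set_option linter.dupNamespace false -- mandated namespace of this single-conjunct summit

namespace Summit.ResolutionOfSingularities.ResolutionOfSingularities.Theorems

open MvPolynomial Finset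
open Literature.AlgebraicGeometry.Resolution
open Literature.AlgebraicGeometry.Resolution.CentreBlowup
open Literature.AlgebraicGeometry.Resolution.Hauser2010

namespace CampaignW46.MohWindowShadeTerminatesFinWitness

variable (K : Type*) [Field K] [DecidableEq K]

/-- **The antecedent of `CampaignW46MohWindowShadeTerminalCentreTerminatesFin 3 K (Fin 3)` is SATISFIABLE with `N = 1`**
(kernel non-vacuity witness beyond the degenerate slice `N = 0`): initial state `(y^{(2,2,1)}, (2,2,1))`, centre
`C_{{0,1}}`, chart `y_0`, the origin, at every stage. [folklore] -/
theorem antecedent_witness :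
    let r₀ : Fin 3 →₀ ℕ := Finsupp.single 0 2 + Finsupp.single 1 2 + Finsupp.single 2 1
    let S : ℕ → Finset (Fin 3) := fun _ => {0, 1}
    let j : ℕ → Fin 3 := fun _ => 0
    let b : ℕ → Fin 3 → K := fun _ _ => 0
    let s : ℕ → CState (Fin 3) K :=
      fun n => Nat.rec (⟨monomial r₀ 1, r₀, Finset.univ⟩ : CState (Fin 3) K) (fun _ t => step 3 {0, 1} 0 (fun _ => 0) t) n
    (∀ n, j n ∈ S n) ∧ (∀ n, b n (j n) = 0) ∧ (∀ n i, i ∉ S n → b n i = 0) ∧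
    (∀ n, s (n + 1) = step 3 (S n) (j n) (b n) (s n)) ∧
    deletePthPowers 3 (s 0).F = (s 0).F ∧ (∀ d ∈ (s 0).F.support, (s 0).r ≤ d) ∧
    ordZero (s 0).F = ((s 0).r.degree : ℕ) ∧ 3 < (s 0).r.degree ∧ (s 0).r.degree < 2 * 3 ∧
    (∀ n, n < 1 → 3 ≤ degIn (S n) (s n).r) ∧
    (∀ n, n < 1 → ∀ i ∈ S n, degIn ((S n).erase i) (s n).r < 3) ∧
    (∀ n, n < 1 → IsEquimultiplePoint 3 (S n) (j n) (b n) (s n)) := by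
  intro r₀ S j b s
  have hr0 : r₀ 0 = 2 := by simp [r₀]
  have hr1 : r₀ 1 = 2 := by simp [r₀]
  have hr2 : r₀ 2 = 1 := by simp [r₀]
  have hdeg : r₀.degree = 5 := by
    show (Finsupp.single (0 : Fin 3) 2 + Finsupp.single 1 2 + Finsupp.single 2 1).degree = 5
    rw [map_add, map_add, Finsupp.degree_single, Finsupp.degree_single, Finsupp.degree_single]
  have hdegIn : degIn ({0, 1} : Finset (Fin 3)) r₀ = 4 := by
    unfold degIn
    rw [Finset.sum_pair (by decide), hr0, hr1]
  have hsF : (s 0).F = monomial r₀ (1 : K) := rfl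
  have hsr : (s 0).r = r₀ := rfl
  have hsupp : (s 0).F.support = {r₀} := by
    rw [hsF, support_monomial, if_neg one_ne_zero]
  have hr : ∀ d ∈ (s 0).F.support, (s 0).r ≤ d := by
    intro d hd
    rw [hsupp, Finset.mem_singleton] at hd
    rw [hd, hsr]
  have hord : ordZero (s 0).F = ((s 0).r.degree : ℕ) := by
    rw [hsF, PointBlowup.ordZero_monomial_one, hsr]
  have hclean : deletePthPowers 3 (s 0).F = (s 0).F := by
    rw [hsF, deletePthPowers_monomial, if_neg]
    intro h
    have := (isPthPowerExponent_iff 3 r₀).mp h 2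
    rw [hr2] at this
    omega
  have hlo : 3 < (s 0).r.degree := by rw [hsr, hdeg]; omega
  have hhi : (s 0).r.degree < 2 * 3 := by rw [hsr, hdeg]; omega
  have hS0 : 3 ≤ degIn (S 0) (s 0).r := by
    show 3 ≤ degIn ({0, 1} : Finset (Fin 3)) (s 0).r
    rw [hsr, hdegIn]; omega
  have hmin0 : ∀ i ∈ S 0, degIn ((S 0).erase i) (s 0).r < 3 := by
    intro i hi
    change i ∈ ({0, 1} : Finset (Fin 3)) at hi
    show degIn (({0, 1} : Finset (Fin 3)).erase i) (s 0).r < 3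
    rw [hsr]
    rcases Finset.mem_insert.mp hi with rfl | hi
    · rw [show (({0, 1} : Finset (Fin 3)).erase 0) = {1} by decide]
      unfold degIn; rw [Finset.sum_singleton, hr1]; omega
    · rw [Finset.mem_singleton] at hi
      subst hi
      rw [show (({0, 1} : Finset (Fin 3)).erase 1) = {0} by decide]
      unfold degIn; rw [Finset.sum_singleton, hr0]; omega
  have heq0 : IsEquimultiplePoint 3 (S 0) (j 0) (b 0) (s 0) := by
    have hj0 : (j 0) ∈ S 0 := by show (0 : Fin 3) ∈ ({0, 1} : Finset (Fin 3)); decide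
    rw [MohWindowShadeTerminalCentres.isEquimultiplePoint_iff 3 hj0 (b 0) rfl (fun _ _ => rfl) (s 0) hr hord
      hlo hhi hS0]
    -- the new multiplicities are `(1, 2, 1)`, of total `4 ≥ 3`
    have happ : ∀ k, (step 3 (S 0) (j 0) (b 0) (s 0)).r k = if k = (0 : Fin 3) then 1 else r₀ k := by
      intro k
      rw [MohWindowShadeTerminalCentres.step_r_apply 3 (S 0) (j 0) (b 0) rfl (s 0) hr hord k, if_pos rfl, hsr]
      by_cases hk : k = 0
      · subst hk
        rw [if_pos rfl, if_pos rfl]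
        show degIn ({0, 1} : Finset (Fin 3)) r₀ - 3 = 1
        rw [hdegIn]
      · rw [if_neg hk, if_neg hk]
    rw [Finsupp.degree_eq_sum, Fin.sum_univ_three, happ 0, happ 1, happ 2, if_pos rfl, if_neg (by decide),
      if_neg (by decide), hr1, hr2]
    omega
  refine ⟨fun _ => by decide, fun _ => rfl, fun _ _ _ => rfl, fun n => rfl, hclean, hr, hord, hlo, hhi,
    fun n hn => ?_, fun n hn => ?_, fun n hn => ?_⟩
  · obtain rfl : n = 0 := by omega
    exact hS0
  · obtain rfl : n = 0 := by omega
    exact hmin0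
  · obtain rfl : n = 0 := by omega
    exact heq0

/-- Hence the repaired statement has a NON-TRIVIAL instance over every field of characteristic `3`: applied to the
witness walk with `N = 1` it yields `1 + 3 ≤ |r₀| = 5` (its general content being `N ≤ |r₀| − p`). [folklore] -/
theorem instance_of_terminatesFin [CharP K 3] (h : CampaignW46MohWindowShadeTerminalCentreTerminatesFin 3 K (Fin 3)) :
    let r₀ : Fin 3 →₀ ℕ := Finsupp.single 0 2 + Finsupp.single 1 2 + Finsupp.single 2 1
    let s : ℕ → CState (Fin 3) K :=
      fun n => Nat.rec (⟨monomial r₀ 1, r₀, Finset.univ⟩ : CState (Fin 3) K) (fun _ t => step 3 {0, 1} 0 (fun _ => 0) t) n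
    1 + 3 ≤ (s 0).r.degree := by
  intro r₀ s
  obtain ⟨hj, hb, hbN, hstep, hclean, hr, hord, hlo, hhi, hS, hmin, heq⟩ := antecedent_witness K
  exact h s _ _ _ hj hb hbN hstep hclean hr hord hlo hhi 1 hS hmin heq

end CampaignW46.MohWindowShadeTerminatesFinWitness

end Summit.ResolutionOfSingularities.ResolutionOfSingularities.Theorems

end
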